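import Literature.NumberTheory.EllipticCurves.FormalGroupLaurentPoints
import Literature.NumberTheory.EllipticCurves.FormalGroupLogHomAbelProofs
import Literature.NumberTheory.EllipticCurves.PadicSigmaUniquenessProofs
import Literature.NumberTheory.EllipticCurves.FrobeniusManinProofs
import Literature.NumberTheory.EllipticCurves.PadicSigma
import Literature.NumberTheory.EllipticCurves.PAdicHeightsLogProofs
import Literature.NumberTheory.EllipticCurves.PadicSeriesEvaluation
import Literature.RingTheory.FormalGroups.HondaTypeUniqueness
import Mathlib.NumberTheory.Basic
import HarnessLib

/-!
# Honda's congruences for the formal logarithm of an elliptic curve with good reduction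
# (`log_E` is of Honda type `p − a_pT + T²`; Honda 1970 Thm. 9 / Hazewinkel §33.1; proofs + 3 defs)

Trunk T-NT-EC (Literature/NumberTheory/EllipticCurves). For an odd prime `p` and a Weierstrass
equation `V` over `ℤ_p` whose generic fibre `W = V ⊗ ℚ_p` and special fibre `Ṽ = V ⊗ 𝔽_p` are
elliptic, with `a = p + 1 − #Ṽ(𝔽_p)` (`HasseManin.tr Ṽ`), the main theorem
`WeierstrassCurve.norm_coeff_hondaShift_formalLog_le_one` states that
`hondaShift p a log_W = log_W(X) − (a/p)·log_W(Xᵖ) + (1/p)·log_W(X^{p²})` has `p`-integral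
coefficients — equivalently the Atkin–Swinnerton-Dyer congruences for the coefficients of the
invariant differential. This is the local-at-`p` "elliptic side" of Honda's proof of the
Eichler–Shimura congruence (our `eichlerShimuraConstruction`, via `HondaTypeTransport`).

## Proof architecture (Honda 1970 §6.2; no modular curves mod `p`)

1. `frob_relation_laurentPt`: `P(X^{p²}) − a•P(Xᵖ) + p•P(X) = O` in `Ṽ(𝔽_p⸨X⸩)` for the formal
   point `P(σ)` of `FormalGroupLaurentPoints` — the tree's `HasseManin.frob_relation`
   (`π² − aπ + p = 0` on the generic point, Manin's elementary proof) pushed along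
   `𝔽_p(Ṽ) → 𝔽_p⸨X⸩` (`WeierstrassFunctionField.funcAlgHom`; `laurentX_transcendental`), using
   `Frob(P(σ)) = P(σᵖ)` (`laurentX/Y_pow_prime`).
2. `frobenius_formal_identity_of_nonneg/_of_neg`: hence the power-series identity
   `F̃(X^{p²}, [p]˜X) = [a]˜(Xᵖ)` (resp. `ĩ[|a|]˜(Xᵖ)`) in `𝔽_p⟦X⟧` (dictionary + injectivity).
3. `map_toZMod_frobLHS_sub_eq_zero`: the same combination of `ℤ_p`-series vanishes mod `p`; so its
   image in `ℚ_p⟦X⟧` is `≡ 0 (mod p)` coefficientwise, and `log_W(u) ≡ log_W(v) (mod p)` for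
   `p`-integral `u ≡ v` (`HondaTypeUniqueness.norm_coeff_subst_sub_subst_le_of_natCast_mul_coeff_le`,
   `n·[Xⁿ]log_W ∈ ℤ_p`).
4. `log_W(F(u₁,u₂)) = log_W u₁ + log_W u₂`, `log_W([m]u) = m log_W u`, `log_W(i u) = −log_W u` turn
   this into `log_W(X^{p²}) + p·log_W − a·log_W(Xᵖ) ≡ 0 (mod p)`, i.e. the claim.

Definitions: `frobLHS`, `frobRHSPos`, `frobRHSNeg` (the three formal-group combinations). No named facts.

## References

* T. Honda, *On the theory of commutative formal groups*, J. Math. Soc. Japan 22 (1970), 213–246,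
  §6.2, Thm. 9. [Honda1970]
* M. Hazewinkel, *Formal Groups and Applications* (1978), §33.1.
* J. H. Silverman, *The Arithmetic of Elliptic Curves*, 2nd ed. (2009), Thm. V.2.3.1(b), IV.5. [cite: SilvermanAEC2009]
-/

noncomputable section

open scoped Classical

/-! ## Frobenius on formal points over `𝔽_p⸨X⸩` and the transport of `π² − aπ + p = 0` -/

namespace WeierstrassCurve

open scoped LaurentSeries
open PowerSeries Literature.NumberTheory.EllipticCurves
open scoped IntermediateField

section Frobenius

variable {p : ℕ} [hp : Fact p.Prime] (E : WeierstrassCurve (ZMod p))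

/-- `f(σ) = f` for `σ = X`. [folklore] -/
theorem _root_.Literature.NumberTheory.EllipticCurves.powerSeries_subst_X_self {R : Type*} [CommRing R]
    (f : R⟦X⟧) : f.subst (PowerSeries.X : R⟦X⟧) = f := by
  rw [← PowerSeries.map_algebraMap_eq_subst_X, Algebra.algebraMap_self, PowerSeries.map_id, id]

/-- **Frobenius on `X(σ)`**: `X(σ)ᵖ = X(σᵖ)` in `𝔽_p⟦X⟧` (the coefficients of `X = formalXMulSq` lie in
`𝔽_p`, `HondaTypeTransport.pow_prime_eq_expand_zmod`). [folklore] -/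
theorem formalXMulSq_subst_pow_prime {σ : (ZMod p)⟦X⟧} (hσ0 : constantCoeff σ = 0) :
    E.formalXMulSq.subst σ ^ p = E.formalXMulSq.subst (σ ^ p) := by
  have hs : PowerSeries.HasSubst σ := PowerSeries.HasSubst.of_constantCoeff_zero' hσ0
  rw [← subst_pow hs, Literature.RingTheory.FormalGroups.pow_prime_eq_expand_zmod, expand_apply,
    subst_comp_subst_apply (PowerSeries.HasSubst.X_pow hp.out.ne_zero) hs, subst_pow hs, subst_X hs]

/-- `σᵖ` has no constant term. [folklore] -/
theorem _root_.Literature.NumberTheory.EllipticCurves.constantCoeff_pow_prime {R : Type*} [CommRing R]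
    {σ : R⟦X⟧} (hσ0 : constantCoeff σ = 0) {n : ℕ} (hn : n ≠ 0) : constantCoeff (σ ^ n) = 0 := by
  rw [map_pow, hσ0, zero_pow hn]

/-- **Frobenius on the `x`-coordinate of a formal point**: `x(σ)ᵖ = x(σᵖ)` in `𝔽_p⸨X⸩`. [folklore] -/
theorem laurentX_pow_prime {σ : (ZMod p)⟦X⟧} (hσ0 : constantCoeff σ = 0) :
    E.laurentX σ ^ p = E.laurentX (σ ^ p) := by
  rw [laurentX, laurentX, ← E.formalXMulSq_subst_pow_prime hσ0, PowerSeries.coe_pow, PowerSeries.coe_pow]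
  ring

/-- **Frobenius on the `y`-coordinate**: `y(σ)ᵖ = y(σᵖ)` (`(−a)ᵖ = −aᵖ` in characteristic `p`).
[folklore] -/
theorem laurentY_pow_prime {σ : (ZMod p)⟦X⟧} (hσ0 : constantCoeff σ = 0) :
    E.laurentY σ ^ p = E.laurentY (σ ^ p) := by
  haveI : CharP (ZMod p)⸨X⸩ p := charP_of_injective_algebraMap (algebraMap (ZMod p) (ZMod p)⸨X⸩).injective p
  rw [laurentY, laurentY, ← E.formalXMulSq_subst_pow_prime hσ0, PowerSeries.coe_pow, PowerSeries.coe_pow,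
    div_pow, neg_pow, neg_one_pow_char (ZMod p)⸨X⸩ p]
  ring

/-- The scalar tower `𝔽_p → 𝔽_p → 𝔽_p⸨X⸩` for the `Algebra` instances used by `Point.map` (with the
whole of Mathlib imported, instance search does not close it by itself). [folklore] -/
theorem _root_.Literature.NumberTheory.EllipticCurves.isScalarTower_zmod_laurent :
    @IsScalarTower (ZMod p) (ZMod p) (ZMod p)⸨X⸩ Algebra.toSMul Algebra.toSMul Algebra.toSMul :=
  IsScalarTower.of_algebraMap_eq (fun _ => rfl)

attribute [local instance] Literature.NumberTheory.EllipticCurves.isScalarTower_zmod_laurent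

variable [E.IsElliptic]

/-- **Frobenius on formal points**: `Frob(P(σ)) = P(σᵖ)`, `Frob` the `p`-power map on
coordinates (`Point.map` of the Frobenius `𝔽_p`-algebra endomorphism of `𝔽_p⸨X⸩`). [folklore] -/
theorem map_frobenius_laurentPt {σ : (ZMod p)⟦X⟧} (hσ0 : constantCoeff σ = 0) :
    Affine.Point.map (FiniteField.frobeniusAlgHom (ZMod p) (ZMod p)⸨X⸩) (E.laurentPt σ hσ0) =
      E.laurentPt (σ ^ p) (constantCoeff_pow_prime hσ0 hp.out.ne_zero) := by
  by_cases hσ : σ = 0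
  · subst hσ
    rw [laurentPt_zero, map_zero, eq_comm,
      laurentPt_congr (E := E) (zero_pow (M₀ := (ZMod p)⟦X⟧) hp.out.ne_zero) _ (map_zero _), laurentPt_zero]
  have hσp : σ ^ p ≠ 0 := pow_ne_zero p hσ
  rw [laurentPt_of_ne_zero hσ0 hσ, laurentPt_of_ne_zero _ hσp, Affine.Point.map_some]
  simp only [Affine.Point.some.injEq, FiniteField.frobeniusAlgHom_apply, ZMod.card]
  exact ⟨E.laurentX_pow_prime hσ0, E.laurentY_pow_prime hσ0⟩

end Frobenius

section Transcendence

variable {k : Type*} [Field k] (E : WeierstrassCurve k)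

omit E in
/-- Constant term of a polynomial expression in a power series. [folklore] -/
theorem _root_.Literature.NumberTheory.EllipticCurves.constantCoeff_aeval_powerSeries (g : k⟦X⟧)
    (P : Polynomial k) :
    constantCoeff (Polynomial.aeval g P) = P.eval (constantCoeff g) := by
  rw [Polynomial.aeval_def, Polynomial.hom_eval₂, Polynomial.eval]
  congr 1

omit E in
/-- **A nonzero power series without constant term is transcendental over the constants**: if
`P(g) = 0` with `P ≠ 0` and `P(0) = 0` then `P = T·P₁` and `P₁(g) = 0` (`g ≠ 0`, `k⟦X⟧` a domain),
so by induction on the degree one reaches `P(0) ≠ 0`; but the constant term of `P(g)` is `P(0)`.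
[folklore] -/
theorem _root_.Literature.NumberTheory.EllipticCurves.powerSeries_transcendental {g : k⟦X⟧}
    (hg0 : constantCoeff g = 0) (hg : g ≠ 0) : Transcendental k g := by
  rintro ⟨P, hP, hPg⟩
  induction hd : P.natDegree using Nat.strong_induction_on generalizing P with
  | _ d ih =>
    by_cases hc : P.coeff 0 = 0
    · have hdiv : P.divX ≠ 0 := by
        intro h0
        apply hP
        rw [← Polynomial.X_mul_divX_add P, h0, hc]; simp
      have hPg' : Polynomial.aeval g P.divX = 0 := by
        have h := hPg
        rw [← Polynomial.X_mul_divX_add P, hc, map_add, map_mul, Polynomial.aeval_X, Polynomial.C_0, map_zero,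
          add_zero] at h
        exact (mul_eq_zero.mp h).resolve_left hg
      have hlt : P.divX.natDegree < d := by
        rw [← hd, Polynomial.natDegree_divX_eq_natDegree_tsub_one]
        have : P.natDegree ≠ 0 := by
          intro h0
          apply hP
          rw [Polynomial.eq_C_of_natDegree_eq_zero h0, hc, Polynomial.C_0]
        omega
      exact ih _ hlt P.divX hdiv hPg' rfl
    · apply hc
      have h := congrArg constantCoeff hPg
      rwa [map_zero, constantCoeff_aeval_powerSeries, hg0, ← Polynomial.coeff_zero_eq_eval_zero] at h

/-- **The `x`-coordinate `x(σ) = X(σ)/σ²` of a formal point is transcendental over `k`** (`σ ≠ 0`):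
`x(σ)⁻¹ = σ²/X(σ)` is a nonzero power series without constant term. [folklore] -/
theorem laurentX_transcendental {σ : k⟦X⟧} (hσ0 : constantCoeff σ = 0) (hσ : σ ≠ 0) :
    Transcendental k (E.laurentX σ) := by
  intro halg
  -- `g = σ² · X(σ)⁻¹`
  have hA1 : constantCoeff (E.formalXMulSq.subst σ) = 1 := constantCoeff_formalXMulSq_subst hσ0
  set g : k⟦X⟧ := σ ^ 2 * PowerSeries.invOfUnit (E.formalXMulSq.subst σ) 1 with hgdef
  have hAi : E.formalXMulSq.subst σ * PowerSeries.invOfUnit (E.formalXMulSq.subst σ) 1 = 1 :=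
    PowerSeries.mul_invOfUnit _ 1 (by rw [hA1, Units.val_one])
  have hA := coe_laurent_ne_zero (formalXMulSq_subst_ne_zero (E := E) hσ0)
  have hsc := coe_laurent_ne_zero hσ
  have hgx : (E.laurentX σ)⁻¹ = ((g : k⟦X⟧) : k⸨X⸩) := by
    have hAi' := congrArg (fun f : k⟦X⟧ => (f : k⸨X⸩)) hAi
    simp only [PowerSeries.coe_mul, PowerSeries.coe_one] at hAi'
    rw [laurentX, inv_div, hgdef, PowerSeries.coe_mul, PowerSeries.coe_pow, div_eq_iff hA]
    linear_combination (-(((σ : k⟦X⟧) : k⸨X⸩) ^ 2)) * hAi'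
  have hg0 : constantCoeff g = 0 := by
    rw [hgdef, map_mul, map_pow, hσ0, zero_pow two_ne_zero, zero_mul]
  have hgne : g ≠ 0 := by
    rw [hgdef]
    refine mul_ne_zero (pow_ne_zero 2 hσ) fun h0 => ?_
    rw [h0, mul_zero] at hAi
    exact zero_ne_one hAi
  apply powerSeries_transcendental hg0 hgne
  obtain ⟨P, hP, hPg⟩ := halg.inv
  rw [hgx] at hPg
  refine ⟨P, hP, HahnSeries.ofPowerSeries_injective (Γ := ℤ) (R := k) ?_⟩
  rw [map_zero, Polynomial.aeval_def, Polynomial.hom_eval₂, ← hPg, Polynomial.aeval_def]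
  rfl

end Transcendence



end WeierstrassCurve

namespace WeierstrassCurve

open scoped LaurentSeries
open PowerSeries Literature.NumberTheory.EllipticCurves

section Transport

variable {p : ℕ} [hp : Fact p.Prime] (E : WeierstrassCurve (ZMod p))

/-- `(x(σ))^{pⁱ} = x(σ^{pⁱ})`. [folklore] -/
theorem laurentX_pow_prime_pow {σ : (ZMod p)⟦X⟧} (hσ0 : constantCoeff σ = 0) (i : ℕ) :
    E.laurentX σ ^ p ^ i = E.laurentX (σ ^ p ^ i) := by
  induction i with
  | zero => rw [pow_zero, pow_one, pow_one]
  | succ i ih =>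
    rw [pow_succ, pow_mul, ih, E.laurentX_pow_prime (constantCoeff_pow_prime hσ0 (pow_ne_zero i hp.out.ne_zero)),
      ← pow_mul]

/-- `(y(σ))^{pⁱ} = y(σ^{pⁱ})`. [folklore] -/
theorem laurentY_pow_prime_pow {σ : (ZMod p)⟦X⟧} (hσ0 : constantCoeff σ = 0) (i : ℕ) :
    E.laurentY σ ^ p ^ i = E.laurentY (σ ^ p ^ i) := by
  induction i with
  | zero => rw [pow_zero, pow_one, pow_one]
  | succ i ih =>
    rw [pow_succ, pow_mul, ih, E.laurentY_pow_prime (constantCoeff_pow_prime hσ0 (pow_ne_zero i hp.out.ne_zero)),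
      ← pow_mul]

variable [E.IsElliptic]

attribute [local instance] Literature.NumberTheory.EllipticCurves.isScalarTower_zmod_laurent

/-- An affine point with the coordinates of a formal point is that formal point. [folklore] -/
theorem some_eq_laurentPt {σ : (ZMod p)⟦X⟧} (hσ0 : constantCoeff σ = 0) (hσ : σ ≠ 0)
    {x y : (ZMod p)⸨X⸩} (hx : x = E.laurentX σ) (hy : y = E.laurentY σ)
    (h : (E.baseChange (ZMod p)⸨X⸩).toAffine.Nonsingular x y) :
    Affine.Point.some x y h = E.laurentPt σ hσ0 := by
  subst hx hy
  rw [laurentPt_of_ne_zero hσ0 hσ]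

/-- **`π² − aπ + p = 0` at the formal point**: in `E(𝔽_p⸨X⸩)`,
`P(X^{p²}) − a • P(Xᵖ) + p • P(X) = O`, where `P(σ) = (x(σ), y(σ))` is the formal point and
`a = p + 1 − #E(𝔽_p)` — the relation `Frob²(Q) − a • Frob(Q) + p • Q = O` for the generic point
`Q` of `E` over its function field (the tree's `HasseManin.frob_relation`, Manin's proof of Silverman AEC
Thm. V.2.3.1(b)) pushed along the `𝔽_p`-algebra map `𝔽_p(E) → 𝔽_p⸨X⸩`, `(t, s) ↦ (x(X), y(X))`
(`WeierstrassFunctionField.funcAlgHom`; `x(X)` is transcendental), under which `Frobⁱ(Q) ↦ P(X^{pⁱ})`.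
[cite: SilvermanAEC2009, Thm. V.2.3.1(b)] -/
theorem frob_relation_laurentPt :
    E.laurentPt ((PowerSeries.X : (ZMod p)⟦X⟧) ^ p ^ 2)
        (constantCoeff_pow_prime PowerSeries.constantCoeff_X (pow_ne_zero 2 hp.out.ne_zero)) -
      Literature.NumberTheory.EllipticCurves.HasseManin.tr E •
        E.laurentPt ((PowerSeries.X : (ZMod p)⟦X⟧) ^ p)
          (constantCoeff_pow_prime PowerSeries.constantCoeff_X hp.out.ne_zero) +
      (p : ℤ) • E.laurentPt (PowerSeries.X : (ZMod p)⟦X⟧) PowerSeries.constantCoeff_X = 0 := by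
  set x : (ZMod p)⸨X⸩ := E.laurentX (PowerSeries.X : (ZMod p)⟦X⟧) with hxdef
  set y : (ZMod p)⸨X⸩ := E.laurentY (PowerSeries.X : (ZMod p)⟦X⟧) with hydef
  have hns : (E.baseChange (ZMod p)⸨X⸩).toAffine.Nonsingular x y :=
    laurent_nonsingular PowerSeries.constantCoeff_X PowerSeries.X_ne_zero
  have h := Literature.NumberTheory.EllipticCurves.HasseManin.evalEval_eq_zero_of_nonsingular E hns
  have ht : Transcendental (ZMod p) x := E.laurentX_transcendental PowerSeries.constantCoeff_X PowerSeries.X_ne_zero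
  set θ := Literature.NumberTheory.EllipticCurves.WeierstrassFunctionField.funcAlgHom (V := E.toAffine) x y h ht
    with hθ
  have hrel := congrArg (Affine.Point.map θ) (Literature.NumberTheory.EllipticCurves.HasseManin.frob_relation E)
  rw [map_zero, map_add, map_sub, map_zsmul, map_zsmul, Affine.Point.map_map,
    Literature.NumberTheory.EllipticCurves.HasseManin.frobPt,
    Literature.NumberTheory.EllipticCurves.HasseManin.genPt, Affine.Point.map_some, Affine.Point.map_some,
    Affine.Point.map_some] at hrel
  have hθT : θ (Literature.NumberTheory.EllipticCurves.HasseManin.gT E) = x :=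
    Literature.NumberTheory.EllipticCurves.WeierstrassFunctionField.funcAlgHom_xF _ _ _ _
  have hθS : θ (Literature.NumberTheory.EllipticCurves.HasseManin.gS E) = y :=
    Literature.NumberTheory.EllipticCurves.WeierstrassFunctionField.funcAlgHom_yF _ _ _ _
  have hX0 : (PowerSeries.X : (ZMod p)⟦X⟧) ≠ 0 := PowerSeries.X_ne_zero
  have hp0 : p ≠ 0 := hp.out.ne_zero
  have e0 := fun hh => E.some_eq_laurentPt PowerSeries.constantCoeff_X hX0 hθT hθS hh
  have e1 := fun hh => E.some_eq_laurentPt (constantCoeff_pow_prime PowerSeries.constantCoeff_X hp0)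
    (pow_ne_zero _ hX0)
    (x := θ (Literature.NumberTheory.EllipticCurves.HasseManin.gT E ^ Fintype.card (ZMod p)))
    (y := θ (Literature.NumberTheory.EllipticCurves.HasseManin.gS E ^ Fintype.card (ZMod p)))
    (by rw [map_pow, hθT, ZMod.card, hxdef, E.laurentX_pow_prime PowerSeries.constantCoeff_X])
    (by rw [map_pow, hθS, ZMod.card, hydef, E.laurentY_pow_prime PowerSeries.constantCoeff_X]) hh
  have e2 := fun hh => E.some_eq_laurentPt
    (constantCoeff_pow_prime PowerSeries.constantCoeff_X (pow_ne_zero 2 hp0)) (pow_ne_zero _ hX0)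
    (x := (θ.comp (Literature.NumberTheory.EllipticCurves.HasseManin.frob E))
      (Literature.NumberTheory.EllipticCurves.HasseManin.gT E ^ Fintype.card (ZMod p)))
    (y := (θ.comp (Literature.NumberTheory.EllipticCurves.HasseManin.frob E))
      (Literature.NumberTheory.EllipticCurves.HasseManin.gS E ^ Fintype.card (ZMod p)))
    (by rw [AlgHom.comp_apply, Literature.NumberTheory.EllipticCurves.HasseManin.frob_apply, map_pow, map_pow,
          hθT, ZMod.card, ← pow_mul, ← sq, hxdef, E.laurentX_pow_prime_pow PowerSeries.constantCoeff_X 2])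
    (by rw [AlgHom.comp_apply, Literature.NumberTheory.EllipticCurves.HasseManin.frob_apply, map_pow, map_pow,
          hθS, ZMod.card, ← pow_mul, ← sq, hydef, E.laurentY_pow_prime_pow PowerSeries.constantCoeff_X 2]) hh
  rw [e0, e1, e2, ZMod.card] at hrel
  exact hrel

end Transport

end WeierstrassCurve

namespace WeierstrassCurve

open scoped LaurentSeries
open PowerSeries Literature.NumberTheory.EllipticCurves

section FormalIdentity

variable {p : ℕ} [hp : Fact p.Prime] (V : WeierstrassCurve ℤ_[p]) [hE : (V.map PadicInt.Coe.ringHom).IsElliptic]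
  [hEt : (V.map PadicInt.toZMod).IsElliptic]

omit hE hEt in
/-- `(2 : 𝔽_p) ≠ 0` for odd `p`. [folklore] -/
theorem _root_.Literature.NumberTheory.EllipticCurves.zmod_two_ne_zero_of_ne_two (hp2 : p ≠ 2) :
    (2 : ZMod p) ≠ 0 := by
  intro h
  have h' : ((2 : ℕ) : ZMod p) = 0 := by exact_mod_cast h
  rw [ZMod.natCast_eq_zero_iff] at h'
  exact hp2 ((Nat.prime_dvd_prime_iff_eq hp.out Nat.prime_two).mp h')

/-- **The Frobenius identity in the formal group of `Ẽ = V ⊗ 𝔽_p`, case `a ≥ 0`**: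
`F̃(X^{p²}, [p]˜(X)) = [a]˜(Xᵖ)` in `𝔽_p⟦X⟧`, `a = p + 1 − #Ẽ(𝔽_p)` — both sides are parameters
of the same formal point `P(X^{p²}) + p • P(X) = a • P(Xᵖ)` (`frob_relation_laurentPt` and the
dictionary `laurentPt_formalGroupLaw` / `laurentPt_formalMul`), and `σ ↦ P(σ)` is injective. This is the
statement "`Frob² − a·Frob + p = 0` in `End(Ê)`" of [Honda 1970, §6.2, proof of Thm. 9] /
[Hazewinkel, Formal Groups, (33.1)]. [cite: SilvermanAEC2009, Thm. V.2.3.1(b)] -/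
theorem frobenius_formal_identity_of_nonneg (hp2 : p ≠ 2)
    (ha : 0 ≤ Literature.NumberTheory.EllipticCurves.HasseManin.tr (V.map PadicInt.toZMod)) :
    MvPowerSeries.subst ![(PowerSeries.X : (ZMod p)⟦X⟧) ^ p ^ 2,
        ((V.map PadicInt.toZMod).formalMul p).subst (PowerSeries.X : (ZMod p)⟦X⟧)] (V.map PadicInt.toZMod).formalGroupLaw =
      ((V.map PadicInt.toZMod).formalMul
        (Literature.NumberTheory.EllipticCurves.HasseManin.tr (V.map PadicInt.toZMod)).toNat).subst
        ((PowerSeries.X : (ZMod p)⟦X⟧) ^ p) := by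
  set a := Literature.NumberTheory.EllipticCurves.HasseManin.tr (V.map PadicInt.toZMod) with hadef
  have h2 := zmod_two_ne_zero_of_ne_two hp2
  have hp0 : p ≠ 0 := hp.out.ne_zero
  have hX : constantCoeff (PowerSeries.X : (ZMod p)⟦X⟧) = 0 := PowerSeries.constantCoeff_X
  have hXp : constantCoeff ((PowerSeries.X : (ZMod p)⟦X⟧) ^ p) = 0 := constantCoeff_pow_prime hX hp0
  have hXp2 : constantCoeff ((PowerSeries.X : (ZMod p)⟦X⟧) ^ p ^ 2) = 0 :=
    constantCoeff_pow_prime hX (pow_ne_zero 2 hp0)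
  have hpX : constantCoeff (((V.map PadicInt.toZMod).formalMul p).subst (PowerSeries.X : (ZMod p)⟦X⟧)) = 0 :=
    (Literature.RingTheory.FormalGroups.constantCoeff_subst_of_constantCoeff_eq_zero hX _).trans
      ((V.map PadicInt.toZMod).constantCoeff_formalMul p)
  have hrel := (V.map PadicInt.toZMod).frob_relation_laurentPt
  rw [← hadef] at hrel
  refine laurentPt_injective (E := V.map PadicInt.toZMod)
    (constantCoeff_formalGroupLaw_subst_pair V PadicInt.toZMod hXp2 hpX)
    ((Literature.RingTheory.FormalGroups.constantCoeff_subst_of_constantCoeff_eq_zero hXp _).trans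
      ((V.map PadicInt.toZMod).constantCoeff_formalMul _)) ?_
  rw [laurentPt_formalGroupLaw V PadicInt.toZMod h2 hXp2 hpX, laurentPt_formalMul V PadicInt.toZMod h2 p hX,
    laurentPt_formalMul V PadicInt.toZMod h2 _ hXp, ← natCast_zsmul, ← natCast_zsmul, Int.toNat_of_nonneg ha]
  rw [sub_add_eq_add_sub, sub_eq_zero] at hrel
  exact hrel

/-- **The Frobenius identity in the formal group of `Ẽ`, case `a < 0`**:
`F̃(X^{p²}, [p]˜(X)) = ĩ([|a|]˜(Xᵖ))`. [cite: SilvermanAEC2009, Thm. V.2.3.1(b)] -/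
theorem frobenius_formal_identity_of_neg (hp2 : p ≠ 2)
    (ha : Literature.NumberTheory.EllipticCurves.HasseManin.tr (V.map PadicInt.toZMod) < 0) :
    MvPowerSeries.subst ![(PowerSeries.X : (ZMod p)⟦X⟧) ^ p ^ 2,
        ((V.map PadicInt.toZMod).formalMul p).subst (PowerSeries.X : (ZMod p)⟦X⟧)] (V.map PadicInt.toZMod).formalGroupLaw =
      (V.map PadicInt.toZMod).formalNeg.subst (((V.map PadicInt.toZMod).formalMul
        (Literature.NumberTheory.EllipticCurves.HasseManin.tr (V.map PadicInt.toZMod)).natAbs).subst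
        ((PowerSeries.X : (ZMod p)⟦X⟧) ^ p)) := by
  set a := Literature.NumberTheory.EllipticCurves.HasseManin.tr (V.map PadicInt.toZMod) with hadef
  have h2 := zmod_two_ne_zero_of_ne_two hp2
  have hp0 : p ≠ 0 := hp.out.ne_zero
  have hX : constantCoeff (PowerSeries.X : (ZMod p)⟦X⟧) = 0 := PowerSeries.constantCoeff_X
  have hXp : constantCoeff ((PowerSeries.X : (ZMod p)⟦X⟧) ^ p) = 0 := constantCoeff_pow_prime hX hp0
  have hXp2 : constantCoeff ((PowerSeries.X : (ZMod p)⟦X⟧) ^ p ^ 2) = 0 :=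
    constantCoeff_pow_prime hX (pow_ne_zero 2 hp0)
  have hpX : constantCoeff (((V.map PadicInt.toZMod).formalMul p).subst (PowerSeries.X : (ZMod p)⟦X⟧)) = 0 :=
    (Literature.RingTheory.FormalGroups.constantCoeff_subst_of_constantCoeff_eq_zero hX _).trans
      ((V.map PadicInt.toZMod).constantCoeff_formalMul p)
  have hm : constantCoeff (((V.map PadicInt.toZMod).formalMul a.natAbs).subst
      ((PowerSeries.X : (ZMod p)⟦X⟧) ^ p)) = 0 :=
    (Literature.RingTheory.FormalGroups.constantCoeff_subst_of_constantCoeff_eq_zero hXp _).trans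
      ((V.map PadicInt.toZMod).constantCoeff_formalMul _)
  have hrel := (V.map PadicInt.toZMod).frob_relation_laurentPt
  rw [← hadef] at hrel
  refine laurentPt_injective (E := V.map PadicInt.toZMod)
    (constantCoeff_formalGroupLaw_subst_pair V PadicInt.toZMod hXp2 hpX) (constantCoeff_formalNeg_subst hm) ?_
  rw [laurentPt_formalGroupLaw V PadicInt.toZMod h2 hXp2 hpX, laurentPt_formalMul V PadicInt.toZMod h2 p hX,
    ← neg_laurentPt hm, laurentPt_formalMul V PadicInt.toZMod h2 _ hXp, ← natCast_zsmul, ← natCast_zsmul,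
    ← neg_zsmul]
  have hna : -((a.natAbs : ℕ) : ℤ) = a := by omega
  rw [hna]
  rw [sub_add_eq_add_sub, sub_eq_zero] at hrel
  exact hrel

end FormalIdentity

end WeierstrassCurve

/-! ## Lifting the Frobenius identity to `ℤ_p` and reading it through `log_W`: the Atkin–
Swinnerton-Dyer / Honda congruences `hondaShift p a log_W ∈ ℤ_p⟦X⟧` -/

namespace WeierstrassCurve

open PowerSeries Literature.NumberTheory.EllipticCurves

section FrobSeries

variable (p : ℕ) {R : Type*} [CommRing R] (U : WeierstrassCurve R)

/-- `G_U = F_U(X^{p²}, [p]_U(X))`: the formal-group combination "`Frob² + p`". [Honda 1970, §6.2] [folklore] -/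
def frobLHS : R⟦X⟧ :=
  MvPowerSeries.subst ![(PowerSeries.X : R⟦X⟧) ^ p ^ 2, (U.formalMul p).subst (PowerSeries.X : R⟦X⟧)]
    U.formalGroupLaw

/-- `[m]_U(Xᵖ)`: the formal-group combination "`m · Frob`". [folklore] -/
def frobRHSPos (m : ℕ) : R⟦X⟧ :=
  (U.formalMul m).subst ((PowerSeries.X : R⟦X⟧) ^ p)

/-- `i_U([m]_U(Xᵖ))`: the formal-group combination "`−m · Frob`". [folklore] -/
def frobRHSNeg (m : ℕ) : R⟦X⟧ :=
  U.formalNeg.subst ((U.formalMul m).subst ((PowerSeries.X : R⟦X⟧) ^ p))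

omit U in
/-- `Xⁿ` has no constant term (`n ≠ 0`). [folklore] -/
theorem constantCoeff_X_pow' {n : ℕ} (hn : n ≠ 0) : constantCoeff ((PowerSeries.X : R⟦X⟧) ^ n) = 0 := by
  rw [map_pow, PowerSeries.constantCoeff_X, zero_pow hn]

/-- `[p](X)` has no constant term. [folklore] -/
theorem constantCoeff_formalMul_subst_X (n : ℕ) :
    constantCoeff ((U.formalMul n).subst (PowerSeries.X : R⟦X⟧)) = 0 :=
  (Literature.RingTheory.FormalGroups.constantCoeff_subst_of_constantCoeff_eq_zero PowerSeries.constantCoeff_X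
    _).trans (U.constantCoeff_formalMul n)

/-- `G_U` has no constant term. [folklore] -/
theorem constantCoeff_frobLHS (hp0 : p ≠ 0) : constantCoeff (frobLHS p U) = 0 :=
  MvPowerSeries.constantCoeff_subst_eq_zero
    (hasSubst_pair (constantCoeff_X_pow' (pow_ne_zero 2 hp0)) (U.constantCoeff_formalMul_subst_X p))
    (fun i => by
      fin_cases i
      · exact constantCoeff_X_pow' (pow_ne_zero 2 hp0)
      · exact U.constantCoeff_formalMul_subst_X p)
    U.constantCoeff_formalGroupLaw

/-- `[m](Xᵖ)` has no constant term. [folklore] -/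
theorem constantCoeff_frobRHSPos (hp0 : p ≠ 0) (m : ℕ) : constantCoeff (frobRHSPos p U m) = 0 :=
  (Literature.RingTheory.FormalGroups.constantCoeff_subst_of_constantCoeff_eq_zero (constantCoeff_X_pow' hp0)
    _).trans (U.constantCoeff_formalMul m)

/-- `i([m](Xᵖ))` has no constant term. [folklore] -/
theorem constantCoeff_frobRHSNeg (hp0 : p ≠ 0) (m : ℕ) : constantCoeff (frobRHSNeg p U m) = 0 :=
  (Literature.RingTheory.FormalGroups.constantCoeff_subst_of_constantCoeff_eq_zero
    (U.constantCoeff_frobRHSPos p hp0 m) _).trans U.constantCoeff_formalNeg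

variable {S : Type*} [CommRing S] (φ : R →+* S)

/-- `G` commutes with base change. [folklore] -/
theorem map_frobLHS (hp0 : p ≠ 0) : (frobLHS p U).map φ = frobLHS p (U.map φ) := by
  have hb : MvPowerSeries.HasSubst
      ![(PowerSeries.X : R⟦X⟧) ^ p ^ 2, (U.formalMul p).subst (PowerSeries.X : R⟦X⟧)] :=
    hasSubst_pair (constantCoeff_X_pow' (pow_ne_zero 2 hp0)) (U.constantCoeff_formalMul_subst_X p)
  rw [frobLHS, frobLHS]
  change MvPowerSeries.map φ (MvPowerSeries.subst _ U.formalGroupLaw) = _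
  rw [MvPowerSeries.map_subst hb, map_formalGroupLaw]
  congr 1
  funext i
  fin_cases i
  · simp only [Fin.zero_eta, Matrix.cons_val_zero]
    change PowerSeries.map φ (PowerSeries.X ^ p ^ 2) = _
    rw [map_pow, PowerSeries.map_X]
  · simp only [Fin.mk_one, Matrix.cons_val_one, Matrix.cons_val_zero]
    change PowerSeries.map φ ((U.formalMul p).subst PowerSeries.X) = _
    rw [powerSeries_map_subst (PowerSeries.HasSubst.X' (R := R)) φ, map_formalMul, PowerSeries.map_X]

/-- `[m](Xᵖ)` commutes with base change. [folklore] -/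
theorem map_frobRHSPos (hp0 : p ≠ 0) (m : ℕ) : (frobRHSPos p U m).map φ = frobRHSPos p (U.map φ) m := by
  rw [frobRHSPos, frobRHSPos, powerSeries_map_subst (PowerSeries.HasSubst.X_pow hp0) φ, map_formalMul, map_pow,
    PowerSeries.map_X]

/-- `i([m](Xᵖ))` commutes with base change. [folklore] -/
theorem map_frobRHSNeg (hp0 : p ≠ 0) (m : ℕ) : (frobRHSNeg p U m).map φ = frobRHSNeg p (U.map φ) m := by
  rw [frobRHSNeg, frobRHSNeg, powerSeries_map_subst
    (PowerSeries.HasSubst.of_constantCoeff_zero' (a := (U.formalMul m).subst ((PowerSeries.X : R⟦X⟧) ^ p))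
      (U.constantCoeff_frobRHSPos p hp0 m)) φ, map_formalNeg,
    powerSeries_map_subst (PowerSeries.HasSubst.X_pow hp0) φ, map_formalMul, map_pow, PowerSeries.map_X]

end FrobSeries

section Identity

variable {p : ℕ} [hp : Fact p.Prime] (V : WeierstrassCurve ℤ_[p]) [hE : (V.map PadicInt.Coe.ringHom).IsElliptic]
  [hEt : (V.map PadicInt.toZMod).IsElliptic]

/-- **The Frobenius identity mod `p`**: `G_V ≡ [a](Xᵖ)` resp. `≡ i([|a|](Xᵖ))` in `𝔽_p⟦X⟧`,
`a = p + 1 − #Ṽ(𝔽_p)`. [cite: SilvermanAEC2009, Thm. V.2.3.1(b)] -/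
theorem map_toZMod_frobLHS_sub_eq_zero (hp2 : p ≠ 2) :
    (frobLHS p V - (if 0 ≤ Literature.NumberTheory.EllipticCurves.HasseManin.tr (V.map PadicInt.toZMod) then
        frobRHSPos p V (Literature.NumberTheory.EllipticCurves.HasseManin.tr (V.map PadicInt.toZMod)).toNat
      else frobRHSNeg p V (Literature.NumberTheory.EllipticCurves.HasseManin.tr (V.map PadicInt.toZMod)).natAbs)).map
      PadicInt.toZMod = 0 := by
  have hp0 : p ≠ 0 := hp.out.ne_zero
  rw [map_sub, map_frobLHS p V _ hp0, sub_eq_zero]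
  split_ifs with ha
  · rw [map_frobRHSPos p V _ hp0]
    exact V.frobenius_formal_identity_of_nonneg hp2 ha
  · rw [map_frobRHSNeg p V _ hp0]
    exact V.frobenius_formal_identity_of_neg hp2 (lt_of_not_ge ha)

end Identity

section Logs

variable {p : ℕ} [hp : Fact p.Prime] (W : WeierstrassCurve ℚ_[p]) [hW : W.IsIntegral ℤ_[p]]

/-- **`n · coeff n log_W ∈ ℤ_p`**: `coeff n log_W = c_{n-1}/n` with `c_{n-1}` a coefficient of the
`p`-integral invariant differential. [Silverman AEC IV.5.5, IV.6.3(a)] [cite: SilvermanAEC2009, IV.5.5] -/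
theorem norm_natCast_mul_coeff_formalLog_le (n : ℕ) : ‖(n : ℚ_[p]) * coeff n W.formalLog‖ ≤ 1 := by
  rcases n with _ | k
  · simp
  · rw [W.coeff_succ_formalLog k, ← mul_assoc, Nat.cast_succ, mul_inv_cancel₀ (by exact_mod_cast Nat.succ_ne_zero k),
      one_mul]
    exact isPadicInt_iff_coeff.mp W.isPadicInt_formalOmega k

omit hW in
/-- `log_W(F_W(u₁, u₂)) = log_W(u₁) + log_W(u₂)` for one-variable arguments. [Silverman AEC IV.5.2]
[cite: SilvermanAEC2009, IV.5.2] -/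
theorem formalLog_subst_formalGroupLaw_pair {u₁ u₂ : ℚ_[p]⟦X⟧} (h₁ : constantCoeff u₁ = 0)
    (h₂ : constantCoeff u₂ = 0) :
    W.formalLog.subst (MvPowerSeries.subst ![u₁, u₂] W.formalGroupLaw) = W.formalLog.subst u₁ + W.formalLog.subst u₂ := by
  have hb : MvPowerSeries.HasSubst ![u₁, u₂] := hasSubst_pair h₁ h₂
  have h := congrArg (MvPowerSeries.subst ![u₁, u₂]) W.formalLog_subst_formalGroupLaw
  rw [MvPowerSeries.subst_add hb, mvSubst_powerSeries_subst W.hasSubst_formalGroupLaw hb,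
    mvSubst_powerSeries_subst (PowerSeries.HasSubst.X _) hb, mvSubst_powerSeries_subst (PowerSeries.HasSubst.X _) hb,
    MvPowerSeries.subst_X hb, MvPowerSeries.subst_X hb] at h
  exact h

/-- **`log_W(G_W) = log_W(X^{p²}) + p · log_W`**. [Honda 1970, §6.2] [folklore] -/
theorem formalLog_subst_frobLHS :
    W.formalLog.subst (frobLHS p W) =
      PowerSeries.expand (p ^ 2) (Literature.RingTheory.FormalGroups.prime_sq_ne_zero p) W.formalLog +
        p • W.formalLog := by
  have hp0 : p ≠ 0 := hp.out.ne_zero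
  rw [frobLHS, W.formalLog_subst_formalGroupLaw_pair (constantCoeff_X_pow' (pow_ne_zero 2 hp0))
    (W.constantCoeff_formalMul_subst_X p), PowerSeries.expand_apply, powerSeries_subst_X_self,
    W.formalLog_subst_formalMul p]

/-- **`log_W([m](Xᵖ)) = m · log_W(Xᵖ)`**. [folklore] -/
theorem formalLog_subst_frobRHSPos (m : ℕ) :
    W.formalLog.subst (frobRHSPos p W m) =
      m • PowerSeries.expand p (Literature.RingTheory.FormalGroups.prime_ne_zero p) W.formalLog := by
  have hp0 : p ≠ 0 := hp.out.ne_zero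
  have hXp : PowerSeries.HasSubst ((PowerSeries.X : ℚ_[p]⟦X⟧) ^ p) := PowerSeries.HasSubst.X_pow hp0
  rw [frobRHSPos, ← subst_comp_subst_apply (W.hasSubst_formalMul m) hXp, W.formalLog_subst_formalMul m,
    PowerSeries.expand_apply, ← PowerSeries.coe_substAlgHom hXp, map_nsmul]

/-- **`log_W(i([m](Xᵖ))) = −m · log_W(Xᵖ)`**. [folklore] -/
theorem formalLog_subst_frobRHSNeg (m : ℕ) :
    W.formalLog.subst (frobRHSNeg p W m) =
      -(m • PowerSeries.expand p (Literature.RingTheory.FormalGroups.prime_ne_zero p) W.formalLog) := by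
  have hp0 : p ≠ 0 := hp.out.ne_zero
  have hP : PowerSeries.HasSubst (frobRHSPos p W m) :=
    PowerSeries.HasSubst.of_constantCoeff_zero' (W.constantCoeff_frobRHSPos p hp0 m)
  rw [frobRHSNeg, ← frobRHSPos, ← subst_comp_subst_apply
    (PowerSeries.HasSubst.of_constantCoeff_zero' W.constantCoeff_formalNeg) hP, W.formalLog_subst_formalNeg,
    ← PowerSeries.coe_substAlgHom hP, map_neg, PowerSeries.coe_substAlgHom, W.formalLog_subst_frobRHSPos m]

/-- `p · hondaShift p a ℓ = ℓ(X^{p²}) + p ℓ − a ℓ(Xᵖ)`. [folklore] -/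
theorem hondaShift_eq_C_mul (a : ℚ_[p]) (ℓ : ℚ_[p]⟦X⟧) :
    Literature.RingTheory.FormalGroups.hondaShift p a ℓ =
      C ((p : ℚ_[p])⁻¹) * (PowerSeries.expand (p ^ 2) (Literature.RingTheory.FormalGroups.prime_sq_ne_zero p) ℓ +
        p • ℓ - a • PowerSeries.expand p (Literature.RingTheory.FormalGroups.prime_ne_zero p) ℓ) := by
  have hp0 : (p : ℚ_[p]) ≠ 0 := by exact_mod_cast hp.out.ne_zero
  rw [Literature.RingTheory.FormalGroups.hondaShift_def, nsmul_eq_mul, smul_eq_C_mul, div_eq_mul_inv, map_mul,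
    one_div, ← map_natCast (C : ℚ_[p] →+* ℚ_[p]⟦X⟧) p]
  have hC : C ((p : ℚ_[p])⁻¹) * C (p : ℚ_[p]) = (1 : ℚ_[p]⟦X⟧) := by
    rw [← map_mul, inv_mul_cancel₀ hp0, map_one]
  linear_combination (-ℓ) * hC

end Logs

section Main

variable {p : ℕ} [hp : Fact p.Prime] (V : WeierstrassCurve ℤ_[p]) [hE : (V.map PadicInt.Coe.ringHom).IsElliptic]
  [hEt : (V.map PadicInt.toZMod).IsElliptic]

omit hE hEt in
/-- Coefficients of a `ℤ_p`-series vanishing mod `p` have norm `≤ p⁻¹` in `ℚ_p`. [folklore] -/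
theorem norm_coeff_map_le_inv_of_map_toZMod {f : ℤ_[p]⟦X⟧} (h : f.map PadicInt.toZMod = 0) (n : ℕ) :
    ‖coeff n (f.map (PadicInt.Coe.ringHom (p := p)))‖ ≤ (p : ℝ)⁻¹ := by
  rw [coeff_map]
  apply norm_le_inv_of_norm_lt_one
  have hn := congrArg (coeff n) h
  rw [coeff_map, map_zero] at hn
  have hmem : coeff n f ∈ RingHom.ker (PadicInt.toZMod (p := p)) := hn
  rw [PadicInt.ker_toZMod, IsLocalRing.mem_maximalIdeal] at hmem
  exact PadicInt.mem_nonunits.mp hmem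

/-- **Honda's congruences for `log_W` (the `p`-adic "Eichler–Shimura relation in the formal group").**
For a Weierstrass equation `V` over `ℤ_p` (`p` odd) with elliptic generic and special fibres, and
`a = p + 1 − #Ṽ(𝔽_p)`: `hondaShift p a log_W = log_W − (a/p) log_W(Xᵖ) + (1/p) log_W(X^{p²})` has
`p`-integral coefficients, i.e. `log_W` is of Honda type `p − aT + T²`. Proof: `G_V − R_V ≡ 0 (mod p)`
(`map_toZMod_frobLHS_sub_eq_zero`, from `π² − aπ + p = 0` on `Ṽ`), so `log_W(G) ≡ log_W(R) (mod p)`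
coefficientwise (`norm_coeff_subst_sub_subst_le_of_natCast_mul_coeff_le`), and
`log_W(G) − log_W(R) = log_W(X^{p²}) + p log_W − a log_W(Xᵖ) = p · hondaShift`.
[Honda, J. Math. Soc. Japan 22 (1970), Thm. 9 (proof); Hazewinkel, Formal Groups, §33.1]
[cite: SilvermanAEC2009, Thm. V.2.3.1(b) with IV.5] -/
theorem norm_coeff_hondaShift_formalLog_le_one (hp2 : p ≠ 2) (n : ℕ) :
    ‖coeff n (Literature.RingTheory.FormalGroups.hondaShift p
        ((Literature.NumberTheory.EllipticCurves.HasseManin.tr (V.map PadicInt.toZMod) : ℤ) : ℚ_[p])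
        (V.map PadicInt.Coe.ringHom).formalLog)‖ ≤ 1 := by
  haveI := V.isIntegral_map_coe
  set W := V.map PadicInt.Coe.ringHom with hWdef
  set a := Literature.NumberTheory.EllipticCurves.HasseManin.tr (V.map PadicInt.toZMod) with hadef
  have hp0 : p ≠ 0 := hp.out.ne_zero
  set Rz : ℤ_[p]⟦X⟧ := if 0 ≤ a then frobRHSPos p V a.toNat else frobRHSNeg p V a.natAbs with hRz
  have hmod : (frobLHS p V - Rz).map PadicInt.toZMod = 0 := V.map_toZMod_frobLHS_sub_eq_zero hp2
  -- the two `ℚ_p`-series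
  set u : ℚ_[p]⟦X⟧ := (frobLHS p V).map PadicInt.Coe.ringHom with hu
  set v : ℚ_[p]⟦X⟧ := Rz.map PadicInt.Coe.ringHom with hv
  have hu' : u = frobLHS p W := by rw [hu, map_frobLHS p V _ hp0]
  have huv : ∀ n, ‖coeff n (u - v)‖ ≤ (p : ℝ)⁻¹ := fun n => by
    rw [hu, hv, ← map_sub]
    exact norm_coeff_map_le_inv_of_map_toZMod hmod n
  have hint : ∀ (f : ℤ_[p]⟦X⟧) (n : ℕ), ‖coeff n (f.map (PadicInt.Coe.ringHom (p := p)))‖ ≤ 1 := fun f n => by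
    rw [coeff_map]; exact PadicInt.norm_le_one _
  have hu0 : constantCoeff u = 0 := by
    rw [hu, ← coeff_zero_eq_constantCoeff, coeff_map, coeff_zero_eq_constantCoeff,
      V.constantCoeff_frobLHS p hp0, map_zero]
  have hv0 : constantCoeff v = 0 := by
    rw [hv, ← coeff_zero_eq_constantCoeff, coeff_map, coeff_zero_eq_constantCoeff, hRz]
    split_ifs
    · rw [V.constantCoeff_frobRHSPos p hp0, map_zero]
    · rw [V.constantCoeff_frobRHSNeg p hp0, map_zero]
  have key := Literature.RingTheory.FormalGroups.norm_coeff_subst_sub_subst_le_of_natCast_mul_coeff_le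
    (W.norm_natCast_mul_coeff_formalLog_le) hu0 (hint _) hv0 (hint _) huv n
  -- compute the logarithms
  have hlog : W.formalLog.subst u - W.formalLog.subst v =
      PowerSeries.expand (p ^ 2) (Literature.RingTheory.FormalGroups.prime_sq_ne_zero p) W.formalLog +
        p • W.formalLog - (a : ℚ_[p]) • PowerSeries.expand p (Literature.RingTheory.FormalGroups.prime_ne_zero p)
          W.formalLog := by
    rw [hu', W.formalLog_subst_frobLHS, hv, hRz]
    split_ifs with ha
    · have hta : ((a.toNat : ℕ) : ℚ_[p]) = (a : ℚ_[p]) := by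
        rw [← Int.cast_natCast, Int.toNat_of_nonneg ha]
      rw [map_frobRHSPos p V _ hp0, ← hWdef, W.formalLog_subst_frobRHSPos,
        ← Nat.cast_smul_eq_nsmul ℚ_[p] a.toNat, hta]
    · have hna : ((a.natAbs : ℕ) : ℤ) = -a := by omega
      have hna' : ((a.natAbs : ℕ) : ℚ_[p]) = -(a : ℚ_[p]) := by
        rw [← Int.cast_natCast, hna, Int.cast_neg]
      rw [map_frobRHSNeg p V _ hp0, ← hWdef, W.formalLog_subst_frobRHSNeg,
        ← Nat.cast_smul_eq_nsmul ℚ_[p] a.natAbs, hna', neg_smul, sub_neg_eq_add, ← sub_eq_add_neg]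
  rw [hondaShift_eq_C_mul, ← hlog, coeff_C_mul, norm_mul, norm_inv]
  have hnp : ‖(p : ℚ_[p])‖ = (p : ℝ)⁻¹ := Padic.norm_p
  rw [hnp, inv_inv]
  have hp' : (0 : ℝ) < p := by exact_mod_cast hp.out.pos
  calc (p : ℝ) * ‖coeff n (W.formalLog.subst u - W.formalLog.subst v)‖ ≤ p * (p : ℝ)⁻¹ :=
        mul_le_mul_of_nonneg_left key hp'.le
    _ = 1 := mul_inv_cancel₀ hp'.ne'


end Main

end WeierstrassCurve
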